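import Summits.HubbardSuperconductivity.HubbardLadder.PairCorrWindowUniformTargets
import Literature.MathematicalPhysics.QuantumLattice.HubbardNNNHoppingPairCorrelatorD4Certificate
import HarnessLib

/-!
# R3-∞ / R4 soundness edge, symmetry-reduced form: ONE `D₄`-reduced window certificate ⇒ certified
# bounds on the ORBIT-AVERAGED pair correlator of EVERY ground state of EVERY large torus

HONEST FRAMING: ladder R1–R4 with certified numbers; no claim on H/H₀.

`PairCorrWindowUniform.lean` restricts the certificate's symmetry reductions to lattice translations,
because the point-group defects `Γ(U_γ) Y − Y` do not vanish in the translation-averaged state of a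
ground-state VECTOR of a degenerate multiplet, so a `D₄`-reduced certificate does not bound `P̄_d(L, r; ψ)`
for every `ψ`. It does, however, bound the ORBIT AVERAGE
`P̄^S_d(L, r; ψ) = |S|⁻¹ Σ_{γ∈S} P̄_d(L, γr; ψ)` for every `ψ` (Literature
`re_orbitState_localPair_corr_eq_sum_div`: the `𝕋_L ⋊ S`-average of `Δ_0† Δ_r` is
`(L²|S|)⁻¹ Σ_{γ∈S} Σ_x Δ_x† Δ_{x+γr}` because the `d_{x²−y²}` pair is a `B₁g` object, `U_γ Δ_x U_γᴴ = ±Δ_{γx}`,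
and the sign squares away). For the order / no-order dichotomy the orbit average is the natural quantity
(`r = (2,0)`, `S = D₄`: the mean of `P̄_d` over `(±2,0), (0,±2)`), and the `S`-reduced relaxation is the
cheaper one (block-diagonalisation by `S`; Wang et al. 2024 §III).

* §1 `SymPairWindowCertTT' t t' U r ε` — the data: as `PairWindowCertTT'` plus the point group `S ∋ 1`
  (closed under multiplication) and identification terms `Γ(U_w U_{γₗ}) Yₗ − Yₗ` with `γₗ ∈ S`;
  `bound L n = (c − Σ‖aₖ‖) + (Σ_σ μ_σ)(n/L² − ν)`.
* §2 `bound_le` / `bound_le_orbitAvgPairCorr` — for every `L ≥ 3` the window fits, `n ≤ |𝕋_L|`,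
  `groundEnergy (hubbardTorusTT' L t t' U) (2n) ≤ u L²`, and EVERY unit ground state `ψ` of the sector
  `(2n, S^z = 0)`: `bound L n ≤ ε · P̄^S_d(L, r; ψ)`.
* §3 the typed thermodynamic-limit TARGETS it feeds (OPEN — no instance exists): `R3InfinityPositiveOrbitRowCert`
  with its proved consequence `orbitAvgPairCorr_ge_eventually_of_row` (eventually in `L`, every ground-state
  vector at `(t, t', U; δ) = (1, t', 8; 1/8)` has `P̄^S_d(L, r; ψ) ≥ b > 0`, hence — pigeonhole,
  `exists_le_of_le_orbitAvgPairCorr` — SOME displacement in the orbit `S·r` with `P̄_d ≥ b`), and the dichotomy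
  pair `R3InfinityOrbitDichotomyCert` (A-upper vs B-lower, separated constants) with its proved consequence
  `separation_eventually_of_R3InfinityOrbitDichotomy`.

Result line (cell brief (iii)), exactly: no certificate instance has been run; nothing is certified at
any size by this file; it is the soundness edge and the typed target only.

References: Wang et al., PRX 14 (2024) 031006 §III [cite: WangEtAl2024, §III]; Han, arXiv:2006.06002
§2–3 [cite: Han2020Bootstrap, §3]; Scalapino, Phys. Rep. 250 (1995) 329 §2 eq. (2.3)–(2.4)
[cite: Scalapino1995, §2 eq. (2.4)]; Qin et al., PRX 10 (2020) 031016 §II [cite: QinEtAl2020, §II eqs. (2)–(4)].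
-/

namespace Summit.HubbardSuperconductivity.HubbardLadder

open Matrix Finset Filter Literature.Probability.LatticeModels
  Literature.MathematicalPhysics.QuantumLattice
open Literature.MathematicalPhysics.QuantumManyBody.StateRelaxation
open Literature.MathematicalPhysics.QuantumLattice.ThermodynamicLimit
open scoped ComplexOrder

noncomputable section

/-! ## §1 The data of an `S`-reduced `t–t'` window certificate for `ε · Δ_0† Δ_r` -/

/-- **A space-group-reduced window certificate for the signed `d`-wave pair objective `ε · Δ_0† Δ_r`**
in the `t–t'` Hubbard model `(t, t', U)`: the fields of `PairWindowCertTT'` with the translation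
identification terms replaced by SPACE-GROUP ones, `Γ(U_w U_γ) Y − Y` with `γ` in a point group `S ∋ 1`
closed under multiplication (`S = {1}`: translations only; `S = D₄`: the fully reduced relaxation of
Wang et al. 2024 §III). Every hypothesis of the soundness theorem is a field; nothing about the Hubbard
ground state is assumed. [cite: WangEtAl2024, §III] [cite: Han2020Bootstrap, §3] -/
structure SymPairWindowCertTT' (t t' U : ℝ) (r : Site 2) (ε : ℝ) where
  /-- inner window `Λ` and outer window `Λ'` -/
  Λ : Finset (Site 2)
  Λ' : Finset (Site 2)
  hΛ : Λ ⊆ Λ'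
  h8 : thicken Λ 1 ⊆ Λ'
  h0 : thicken ({0} : Finset (Site 2)) 1 ⊆ Λ'
  hz : (0 : Site 2) ∈ Λ'
  /-- the objective's pair regions lie in the window -/
  hp0 : pairRegion (insert 0 unitSteps) 0 ⊆ Λ'
  hpr : pairRegion (insert 0 unitSteps) r ⊆ Λ'
  /-- energy constraint: weight `κ ≥ 0` and ceiling `u` -/
  κ : ℝ
  κ_nonneg : 0 ≤ κ
  u : ℝ
  /-- density multipliers `μ_σ (n_{0σ} − ν·1)` -/
  μ : Fin 2 → ℝ
  ν : ℝ
  /-- the SOS / Gram part -/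
  m : ℕ
  Λm : Matrix (Fin m) (Fin m) ℂ
  hΛm : Λm.PosSemidef
  O : Fin m → FermionOp Λ'
  /-- equation-of-motion multipliers `[H^{tt'}_{Λ'}, B_k]` -/
  k₁ : ℕ
  B : Fin k₁ → FermionOp Λ
  /-- the point group `S ∋ 1`, closed under multiplication -/
  S : Finset (DihedralGroup 4)
  h1S : (1 : DihedralGroup 4) ∈ S
  hmulS : ∀ a ∈ S, ∀ b ∈ S, a * b ∈ S
  /-- space-group identification terms `Γ(U_w U_γ) Y − Y`, `γₗ ∈ S` -/
  k₂ : ℕ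
  γ : Fin k₂ → DihedralGroup 4
  hγS : ∀ l, γ l ∈ S
  wv : Fin k₂ → Site 2
  hsh : ∀ l, d4ShiftSet (γ l) (wv l) Λ ⊆ Λ'
  Y : Fin k₂ → FermionOp Λ
  /-- charge / spin-charge ladder words -/
  k₃ : ℕ
  b : Fin k₃ → ℂ
  cw : Fin k₃ → List (Orb (PolySite Λ') × Bool)
  hcw : ∀ j, ladderCharge (cw j) ≠ 0 ∨ ladderSpinCharge (cw j) ≠ 0
  /-- anti-Hermitian parts -/
  k₄ : ℕ
  dc : Fin k₄ → ℝ
  V : Fin k₄ → FermionOp Λ'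
  /-- residual words with their coefficients, and the constant `c` -/
  k₅ : ℕ
  a : Fin k₅ → ℂ
  word : Fin k₅ → List (Orb (PolySite Λ') × Bool)
  c : ℝ
  /-- the certificate identity in the CAR algebra of the window -/
  hcert : ((ε : ℝ) : ℂ) • windowPairCorrObs (insert 0 unitSteps) dWaveFormFactor r hp0 hpr - (c : ℂ) • (1 : FermionOp Λ') -
        ∑ σ : Fin 2, ((μ σ : ℝ) : ℂ) • (nAt 0 hz σ - ((ν : ℝ) : ℂ) • (1 : FermionOp Λ')) -
        ((κ : ℝ) : ℂ) • (((u : ℝ) : ℂ) • (1 : FermionOp Λ') -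
          fermionEmbed (PolySite.incl h0) ((hubbardTTPrimeFermionInteraction t t' U).meanEnergyObs 1)) =
      gramForm Λm O +
        (∑ k ∈ univ, ((hubbardTTPrimeFermionInteraction t t' U).localHamiltonian Λ' * fermionEmbed (PolySite.incl hΛ) (B k) -
            fermionEmbed (PolySite.incl hΛ) (B k) * (hubbardTTPrimeFermionInteraction t t' U).localHamiltonian Λ') +
          ∑ l ∈ univ, (fermionEmbed (PolySite.incl (hsh l)) (fermionEmbed (PolySite.d4Emb (γ l) (wv l) Λ) (Y l)) -
            fermionEmbed (PolySite.incl hΛ) (Y l)) +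
          ∑ j ∈ univ, b j • ladderWord (cw j)) +
        (∑ m' ∈ univ, ((dc m' : ℝ) : ℂ) • ((V m')ᴴ - V m') + ∑ k ∈ univ, a k • ladderWord (word k))

/-- **The orbit-averaged `d`-wave pair correlator** `P̄^S_d(L, r; ψ) = |S|⁻¹ Σ_{γ∈S} P̄_d(L, γ r; ψ)`.
[cite: Scalapino1995, §2 eq. (2.4)] -/
def orbitAvgPairCorr (S : Finset (DihedralGroup 4)) (L : ℕ) (r : Site 2)
    (ψ : Fock (Orb (FermionTorus 2 L))) : ℝ :=
  (∑ γ ∈ S, avgPairCorr L (d4Vec γ r) ψ) / S.card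

/-- Pigeonhole: if `b ≤ P̄^S_d(L, r; ψ)` then some `γ ∈ S` has `b ≤ P̄_d(L, γ r; ψ)`. [folklore: mean ≤ max] -/
theorem exists_le_of_le_orbitAvgPairCorr {S : Finset (DihedralGroup 4)} (hS : S.Nonempty) {L : ℕ}
    {r : Site 2} {ψ : Fock (Orb (FermionTorus 2 L))} {b : ℝ} (h : b ≤ orbitAvgPairCorr S L r ψ) :
    ∃ γ ∈ S, b ≤ avgPairCorr L (d4Vec γ r) ψ := by
  by_contra hne
  simp only [not_exists, not_and, not_le] at hne
  have hlt : ∑ γ ∈ S, avgPairCorr L (d4Vec γ r) ψ < ∑ γ ∈ S, (fun _ => b) γ :=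
    Finset.sum_lt_sum_of_nonempty hS fun γ hγ => hne γ hγ
  rw [Finset.sum_const, nsmul_eq_mul] at hlt
  have hcard : (0 : ℝ) < S.card := by exact_mod_cast hS.card_pos
  have : orbitAvgPairCorr S L r ψ < b := by
    unfold orbitAvgPairCorr
    rw [div_lt_iff₀ hcard]
    linarith
  linarith

namespace SymPairWindowCertTT'

variable {t t' U : ℝ} {r : Site 2} {ε : ℝ}

/-- `q = c − Σₖ ‖aₖ‖`. [cite: Han2020Bootstrap, §3] -/
def q (C : SymPairWindowCertTT' t t' U r ε) : ℝ := C.c - ∑ k, ‖C.a k‖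

/-- **The certified number** on the torus of side `L` at `n` pairs: `bound L n = q + (Σ_σ μ_σ)(n/L² − ν)`.
[cite: WangEtAl2024, §III] -/
def bound (C : SymPairWindowCertTT' t t' U r ε) (L n : ℕ) : ℝ :=
  C.q + (∑ σ : Fin 2, C.μ σ) * ((n : ℝ) / (L : ℝ) ^ 2 - C.ν)

/-! ## §2 Soundness on every torus, for every ground-state vector -/

/-- **Soundness, uniform in `L`, every vector.** For every `L ≥ 3` into which the window fits, every
`n ≤ |𝕋_L|` with `groundEnergy (hubbardTorusTT' L t t' U) (2n) / L² ≤ u`, and EVERY unit ground state `ψ`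
of the sector `(2n, S^z = 0)`:
`bound L n ≤ ε · |S|⁻¹ Σ_{γ∈S} Re ⟨ψ, O_{γr} ψ⟩ / L²` (`O_r = pairCorrOp L r = Σ_x Δ_x† Δ_{x+r}`).
(Literature `re_orbitState_ge_of_window_certificate_d4_TT'_groundState` for the point group `S`,
`fermionEmbed_toTorusEmb_windowPairCorrObs_localPair`, `re_orbitState_localPair_corr_eq_sum_div` with the
`B₁g` sign of the `d`-wave factor.) [cite: WangEtAl2024, §III] -/
theorem bound_le (C : SymPairWindowCertTT' t t' U r ε) {L : ℕ} [NeZero L] (hL : 3 ≤ L)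
    (hInj : Set.InjOn (Torus.proj (d := 2) L) ↑(thicken C.Λ' 1)) {n : ℕ}
    (hn : n ≤ Fintype.card (FermionTorus 2 L))
    (hu : groundEnergy (hubbardTorusTT' L t t' U) (2 * n) / (L : ℝ) ^ 2 ≤ C.u)
    {ψ : Fock (Orb (FermionTorus 2 L))} (hGS : IsGroundStateInSector (hubbardTorusTT' L t t' U) (2 * n) 0 ψ)
    (hψ1 : star ψ ⬝ᵥ ψ = 1) :
    C.bound L n ≤ ε * ((∑ γ' ∈ C.S, (star ψ ⬝ᵥ pairCorrOp L (d4Vec γ' r) *ᵥ ψ).re / (L : ℝ) ^ 2) / C.S.card) := by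
  have hInj' : Set.InjOn (Torus.proj (d := 2) L) ↑C.Λ' :=
    hInj.mono (by exact_mod_cast subset_thicken C.Λ' 1)
  have h := re_orbitState_ge_of_window_certificate_d4_TT'_groundState t t' U hL hn C.hΛ C.h8 C.h0 C.hz hInj
    hInj' C.h1S C.hmulS hGS hψ1 C.κ_nonneg hu
    (((ε : ℝ) : ℂ) • windowPairCorrObs (insert 0 unitSteps) dWaveFormFactor r C.hp0 C.hpr) C.μ C.ν C.hΛm C.O
    univ C.B univ C.γ (fun l _ => C.hγS l) C.wv C.hsh C.Y univ C.b C.cw (fun j _ => C.hcw j) univ C.dc C.V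
    univ C.a C.word C.hcert
  rw [fermionEmbed_smul, LinearMap.map_smul, fermionEmbed_toTorusEmb_windowPairCorrObs_localPair, smul_eq_mul,
    Complex.re_ofReal_mul,
    re_orbitState_localPair_corr_eq_sum_div C.h1S dWaveFormFactor b1gSign (fun γ _ => b1gSign_mul_self γ)
      (fun γ _ e => dWaveFormFactor_d4Vec_eq_b1gSign_mul γ e)] at h
  have hrw : (∑ γ' ∈ C.S, (star ψ ⬝ᵥ pairCorrOp L (d4Vec γ' r) *ᵥ ψ).re / (L : ℝ) ^ 2) / C.S.card =
      (∑ γ' ∈ C.S, (star ψ ⬝ᵥ ((∑ x : TorusSite 2 L, (localPair dWaveFormFactor L x)ᴴ *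
          localPair dWaveFormFactor L (x + d4Site γ' (Torus.proj L r))) *ᵥ ψ)).re) / ((L : ℝ) ^ 2 * C.S.card) := by
    simp_rw [pairCorrOp, Torus.proj_d4Vec]
    rw [← Finset.sum_div, div_div]
  rw [hrw]
  exact h

/-- Soundness restated on the orbit-averaged correlator: `bound L n ≤ ε · P̄^S_d(L, r; ψ)`.
[cite: QinEtAl2020, §II eqs. (2)–(4)] -/
theorem bound_le_orbitAvgPairCorr (C : SymPairWindowCertTT' t t' U r ε) (m : ℕ) (hL : 3 ≤ m + 1)
    (hInj : Set.InjOn (Torus.proj (d := 2) (m + 1)) ↑(thicken C.Λ' 1)) {n : ℕ}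
    (hn : n ≤ Fintype.card (FermionTorus 2 (m + 1)))
    (hu : groundEnergy (hubbardTorusTT' (m + 1) t t' U) (2 * n) / ((m + 1 : ℕ) : ℝ) ^ 2 ≤ C.u)
    {ψ : Fock (Orb (FermionTorus 2 (m + 1)))}
    (hGS : IsGroundStateInSector (hubbardTorusTT' (m + 1) t t' U) (2 * n) 0 ψ) (hψ1 : star ψ ⬝ᵥ ψ = 1) :
    C.bound (m + 1) n ≤ ε * orbitAvgPairCorr C.S (m + 1) r ψ := by
  unfold orbitAvgPairCorr
  simp_rw [avgPairCorr_eq_re_expect_pairCorrOp]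
  exact C.bound_le hL hInj hn hu hGS hψ1

/-- At exact filling `n = pairNumber δ L` with `ν = (1−δ)/2` the certified number tends to `q`; any
`b < q` is eventually below it (`|bound − q| ≤ |Σ_σ μ_σ| / L²`). [folklore: archimedean bookkeeping] -/
theorem bound_ge_eventually (C : SymPairWindowCertTT' t t' U r ε) {δ : ℝ} (hδ : δ ≤ 1)
    (hν : C.ν = (1 - δ) / 2) {b : ℝ} (hb : b < C.q) :
    ∃ L₀ : ℕ, ∀ L : ℕ, L₀ ≤ L → b ≤ C.bound L (pairNumber δ L) := by
  set M := |∑ σ : Fin 2, C.μ σ| with hM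
  obtain ⟨L₀, hL₀⟩ := exists_nat_gt (max 1 (M / (C.q - b)))
  refine ⟨L₀, fun L hL => ?_⟩
  have hqb : 0 < C.q - b := sub_pos.2 hb
  have hL0r : (L₀ : ℝ) ≤ L := by exact_mod_cast hL
  have hL1 : (1 : ℝ) < L := lt_of_lt_of_le ((le_max_left _ _).trans_lt hL₀) hL0r
  have hLM : M / (C.q - b) < L := lt_of_lt_of_le ((le_max_right _ _).trans_lt hL₀) hL0r
  have hL2 : (0 : ℝ) < (L : ℝ) ^ 2 := by positivity
  obtain ⟨hgt, hle⟩ := two_mul_pairNumber_bounds hδ L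
  have hy : |(pairNumber δ L : ℝ) - C.ν * (L : ℝ) ^ 2| ≤ 1 := by
    rw [hν, abs_le]; constructor <;> linarith
  have key : C.bound L (pairNumber δ L) - C.q =
      (∑ σ : Fin 2, C.μ σ) * (((pairNumber δ L : ℝ) - C.ν * (L : ℝ) ^ 2) / (L : ℝ) ^ 2) := by
    unfold bound
    rw [sub_div, mul_div_cancel_right₀ _ hL2.ne']
    ring
  have habs : |C.bound L (pairNumber δ L) - C.q| ≤ M / (L : ℝ) ^ 2 := by
    rw [key, abs_mul, abs_div, abs_of_pos hL2, hM]
    calc |∑ σ : Fin 2, C.μ σ| * (|(pairNumber δ L : ℝ) - C.ν * (L : ℝ) ^ 2| / (L : ℝ) ^ 2)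
        ≤ |∑ σ : Fin 2, C.μ σ| * (1 / (L : ℝ) ^ 2) := by gcongr
      _ = |∑ σ : Fin 2, C.μ σ| / (L : ℝ) ^ 2 := by ring
  -- `M / L² ≤ M / L < q − b`
  have hM0 : 0 ≤ M := abs_nonneg _
  have hML : M / (L : ℝ) ^ 2 ≤ M / L :=
    div_le_div_of_nonneg_left hM0 (by positivity) (by nlinarith)
  have hML' : M / (L : ℝ) < C.q - b := by
    rw [div_lt_iff₀ (by positivity)]
    rw [div_lt_iff₀ hqb] at hLM
    linarith [mul_comm (C.q - b) (L : ℝ)]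
  have h := (abs_le.1 habs).1
  linarith

end SymPairWindowCertTT'

/-! ## §3 The thermodynamic-limit target fed by a symmetric certificate (OPEN) -/

/-- **TARGET (R3-∞, symmetric form; OPEN — no instance exists).** A CERTIFIED POSITIVE `S`-reduced
lower row at `(t, t', U; δ) = (1, t', 8; 1/8)` for the orbit of the displacement `r`: an `S`-reduced window
certificate `C` for `+Δ_0† Δ_r` with `ν = 7/16` (= `n̄/2`, `n̄ = 1 − δ = 7/8`), an energy ceiling `u`
STRICTLY above the thermodynamic-limit energy density `energyDensityTT' 1 t' 8 (7/8)` (so that it is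
eventually admissible on every torus, `uniformEnergyCeiling_of_energyDensityTT'_lt`), and `q = c − Σ‖aₖ‖ > 0`.
An instance is produced by an SDP + rational rounding (`Bounds.D4WindowCertTT'` pattern) once the numerics
gate opens; whether ANY exists (i.e. whether the `S`-reduced energy-window relaxation at `U = 8` is tight
enough to see pairing order at distance `|r|`) is the open question this target types (Wang et al. 2024
§III report windows 2–4 orders too wide at accessible sizes). [cite: WangEtAl2024, §III] -/
structure R3InfinityPositiveOrbitRowCert (t' : ℝ) (r : Site 2) where
  /-- the certificate (lower row, `ε = 1`) -/
  C : SymPairWindowCertTT' 1 t' 8 r 1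
  /-- density value `ν = n̄/2 = 7/16` -/
  hν : C.ν = 7 / 16
  /-- the energy ceiling is strictly above the TL energy density at `n̄ = 7/8` -/
  hu : energyDensityTT' 1 t' 8 (7 / 8) < C.u
  /-- the certified constant is positive -/
  hq : 0 < C.q

/-- **Consequence of the target (proved): eventual positive orbit-averaged pair correlation of EVERY
ground state.** From `R3InfinityPositiveOrbitRowCert t' r`: there are `b > 0` and `L₁` such that for every
side `m + 1 ≥ L₁` and every unit ground state `ψ` of `hubbardTorusTT' (m+1) 1 t' 8` in the sector
`(electronNumber (1/8) (m+1), S^z = 0)`, `b ≤ P̄^S_d(m+1, r; ψ)` — hence some displacement `γ r`, `γ ∈ S`,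
has `P̄_d(m+1, γ r; ψ) ≥ b` (`exists_le_of_le_orbitAvgPairCorr`). (`b = q/2`.) [cite: WangEtAl2024, §III] -/
theorem orbitAvgPairCorr_ge_eventually_of_row {t' : ℝ} {r : Site 2} (h : R3InfinityPositiveOrbitRowCert t' r) :
    ∃ b : ℝ, 0 < b ∧ ∃ L₁ : ℕ, ∀ m : ℕ, L₁ ≤ m + 1 →
      ∀ ψ : Fock (Orb (FermionTorus 2 (m + 1))), star ψ ⬝ᵥ ψ = 1 →
        IsGroundStateInSector (hubbardTorusTT' (m + 1) 1 t' 8) (electronNumber (1 / 8) (m + 1)) 0 ψ →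
          b ≤ orbitAvgPairCorr h.C.S (m + 1) r ψ := by
  have hδ : (1 : ℝ) - 1 / 8 = 7 / 8 := by norm_num
  obtain ⟨L₀, hL₀⟩ := uniformEnergyCeiling_of_energyDensityTT'_lt (t := 1) (t' := t') (U := 8)
    (by norm_num) (δ := 1 / 8) (by norm_num) (by norm_num) (u := h.C.u) (by rw [hδ]; exact h.hu)
  obtain ⟨La, hLa⟩ := exists_forall_le_injOn_proj (thicken h.C.Λ' 1)
  obtain ⟨Lb, hLb⟩ := h.C.bound_ge_eventually (δ := 1 / 8) (by norm_num) (by rw [h.hν]; norm_num)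
    (b := h.C.q / 2) (by linarith [h.hq])
  refine ⟨h.C.q / 2, by linarith [h.hq], max 3 (max L₀ (max La Lb)), fun m hm ψ hψ1 hGS => ?_⟩
  simp only [max_le_iff] at hm
  obtain ⟨h3, hL0, hLa', hLb'⟩ := hm
  rw [electronNumber_eq] at hGS
  have hE := hL₀ (m + 1) hL0
  rw [electronNumber_eq] at hE
  have hb := h.C.bound_le_orbitAvgPairCorr m h3 (hLa _ hLa') (pairNumber_le_card (by norm_num) _) hE hGS hψ1
  rw [one_mul] at hb
  exact (hLb _ hLb').trans hb

/-- **TARGET (R3-∞ dichotomy, symmetric form; OPEN — no instance exists).** The orbit-averaged version of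
`PairCorrWindowUniformTargets.R3InfinityDichotomyCert` with the two rows that carry the dichotomy: an
`S`-reduced UPPER certificate `Ahi` for model A `(1, 0, 8)` and an `S`-reduced LOWER certificate `Blo` for
model B `(1, −1/4, 8)`, same point group `S`, both at `ν = 7/16` with energy ceilings strictly above the
respective TL energy densities at `n̄ = 7/8`, and SEPARATED constants `−q(Ahi) < q(Blo)` (A's certified
ceiling on the orbit-averaged pair correlator lies below B's certified floor). This is the Lean reading
of hypothesis H₀ (A: no `d`-wave order; B: order) at ONE distance class `S·r`, as a pair of certificates;
whether such a pair exists is exactly what the R3-∞ campaign would decide (R3-DESIGN §13). Nothing here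
claims it does. [cite: WangEtAl2024, §III] [cite: XuEtAl2024, eq. (1)] -/
structure R3InfinityOrbitDichotomyCert (r : Site 2) where
  /-- upper row (`ε = −1`) for model A, `t' = 0` -/
  Ahi : SymPairWindowCertTT' 1 0 8 r (-1)
  /-- lower row (`ε = 1`) for model B, `t' = −1/4` -/
  Blo : SymPairWindowCertTT' 1 (-1 / 4) 8 r 1
  /-- the same point group (same orbit average on both sides) -/
  hS : Ahi.S = Blo.S
  hνa : Ahi.ν = 7 / 16
  hνb : Blo.ν = 7 / 16
  huA : energyDensityTT' 1 0 8 (7 / 8) < Ahi.u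
  huB : energyDensityTT' 1 (-1 / 4) 8 (7 / 8) < Blo.u
  /-- separation of the certified constants -/
  hsep : -Ahi.q < Blo.q

/-- **Consequence of the target (proved): an eventual certified SEPARATION of the two models.** From
`R3InfinityOrbitDichotomyCert r`: thresholds `θ₁ < θ₂` and a side `L₁` such that on every torus of side
`m + 1 ≥ L₁`, at `N = electronNumber (1/8) (m+1)`, `S^z = 0`: every unit ground state of model A has
orbit-averaged pair correlator `≤ θ₁`, and every unit ground state of model B has it `≥ θ₂`.
(`θ₁ = −q(Ahi) + g/3`, `θ₂ = q(Blo) − g/3`, `g = q(Blo) + q(Ahi) > 0`.) [cite: WangEtAl2024, §III] -/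
theorem separation_eventually_of_R3InfinityOrbitDichotomy {r : Site 2} (h : R3InfinityOrbitDichotomyCert r) :
    ∃ θ₁ θ₂ : ℝ, θ₁ < θ₂ ∧ ∃ L₁ : ℕ, ∀ m : ℕ, L₁ ≤ m + 1 →
      (∀ ψ : Fock (Orb (FermionTorus 2 (m + 1))), star ψ ⬝ᵥ ψ = 1 →
        IsGroundStateInSector (hubbardTorusTT' (m + 1) 1 0 8) (electronNumber (1 / 8) (m + 1)) 0 ψ →
          orbitAvgPairCorr h.Blo.S (m + 1) r ψ ≤ θ₁) ∧
      (∀ ψ : Fock (Orb (FermionTorus 2 (m + 1))), star ψ ⬝ᵥ ψ = 1 →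
        IsGroundStateInSector (hubbardTorusTT' (m + 1) 1 (-1 / 4) 8) (electronNumber (1 / 8) (m + 1)) 0 ψ →
          θ₂ ≤ orbitAvgPairCorr h.Blo.S (m + 1) r ψ) := by
  have hδ : (1 : ℝ) - 1 / 8 = 7 / 8 := by norm_num
  set g := h.Blo.q + h.Ahi.q with hg
  have hg0 : 0 < g := by rw [hg]; linarith [h.hsep]
  obtain ⟨LA, hLA⟩ := uniformEnergyCeiling_of_energyDensityTT'_lt (t := 1) (t' := 0) (U := 8)
    (by norm_num) (δ := 1 / 8) (by norm_num) (by norm_num) (u := h.Ahi.u) (by rw [hδ]; exact h.huA)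
  obtain ⟨LB, hLB⟩ := uniformEnergyCeiling_of_energyDensityTT'_lt (t := 1) (t' := -1 / 4) (U := 8)
    (by norm_num) (δ := 1 / 8) (by norm_num) (by norm_num) (u := h.Blo.u) (by rw [hδ]; exact h.huB)
  obtain ⟨La, hLa⟩ := exists_forall_le_injOn_proj (thicken h.Ahi.Λ' 1)
  obtain ⟨Lb, hLb⟩ := exists_forall_le_injOn_proj (thicken h.Blo.Λ' 1)
  obtain ⟨Ma, hMa⟩ := h.Ahi.bound_ge_eventually (δ := 1 / 8) (by norm_num) (by rw [h.hνa]; norm_num)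
    (b := h.Ahi.q - g / 3) (by linarith)
  obtain ⟨Mb, hMb⟩ := h.Blo.bound_ge_eventually (δ := 1 / 8) (by norm_num) (by rw [h.hνb]; norm_num)
    (b := h.Blo.q - g / 3) (by linarith)
  refine ⟨-h.Ahi.q + g / 3, h.Blo.q - g / 3, by linarith,
    max 3 (max (max LA LB) (max (max La Lb) (max Ma Mb))), fun m hm => ?_⟩
  simp only [max_le_iff] at hm
  obtain ⟨h3, ⟨hLA', hLB'⟩, ⟨hLa', hLb'⟩, hMa', hMb'⟩ := hm
  refine ⟨fun ψ hψ1 hGS => ?_, fun ψ hψ1 hGS => ?_⟩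
  · rw [electronNumber_eq] at hGS
    have hE := hLA (m + 1) hLA'
    rw [electronNumber_eq] at hE
    have hb := h.Ahi.bound_le_orbitAvgPairCorr m h3 (hLa _ hLa') (pairNumber_le_card (by norm_num) _) hE hGS hψ1
    rw [h.hS, neg_one_mul] at hb
    linarith [hMa _ hMa']
  · rw [electronNumber_eq] at hGS
    have hE := hLB (m + 1) hLB'
    rw [electronNumber_eq] at hE
    have hb := h.Blo.bound_le_orbitAvgPairCorr m h3 (hLb _ hLb') (pairNumber_le_card (by norm_num) _) hE hGS hψ1
    rw [one_mul] at hb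
    linarith [hMb _ hMb']

end

end Summit.HubbardSuperconductivity.HubbardLadder
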